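import Mathlib
import HarnessLib

/-!
# ζ(5) search — Stirling rate of the boundary term on the numerator-free face (cell `pub-zeta5`, fam-vwp gen 6, file 2)

HONEST FRAMING: systematic search; no irrationality claim unless certified.
(Filed for `fam-vwp` g6 by the lead/lit g12 lane: mathematics byte-identical to the staged file sha256 90ac2922…; one-line
docstrings added on helper lemmas for the gate's docstring lint, nothing else changed.)

Companion to `WellPoisedFaceEnvelope.lean` (same seat; filed separately and importing neither way, so either can land
first).  Source: W. Zudilin, *Arithmetic of linear forms involving odd zeta values*, J. Théor. Nombres Bordeaux 16
(2004), §8 [cite: Zudilin2004, §8 (8.2), (8.6), (8.7)], with `r = 3`, `q = 7` (the ζ(5)-only box).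

On the numerator-free face `h₁ = h₂ = h₃ = 1` the pair factors of (8.7) are `≡ 1` and
`R(t) = (h₀ + 2t) · ∏_{j=4}^{7} (h₀ − 2h_j)! / (t + h_j)_{h₀ − 2h_j + 1}`, `F(h) = ½ Σ_{t ≥ 0} R″(t)`.  OUR boundary lemma
(families/vwp/FAMILY.md §14.2) says: (i) `R > 0` is log-convex on `t ≥ 0`, so `R″ > 0`; (ii) `18 R(0)/h₀² ≤ F(h) ≤ 125 h₀³ R(0)`;
(iii) along the ray `h₀ = η₀ n + 2`, `h_j = η_j n + 1` one has, since `(h_j)_{h₀−2h_j+1} = (h₀ − h_j)!/(h_j − 1)!`,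
`R_n(0) = h₀ · ∏_j (h₀ − 2h_j)! (h_j − 1)! / (h₀ − h_j)!` and `(1/n) log R_n(0) → −Σ_j g(η₀, η_j)`,
`g(η₀, η) = (η₀ − η) log(η₀ − η) − (η₀ − 2η) log(η₀ − 2η) − η log η`.  Together: the decay rate of `F` on the face is
`C₀ = Σ_j g(η₀, η_j)` — the quantity `FaceDir.C0` whose envelope the companion file proves.

THIS FILE PROVES (iii) IN THE KERNEL (`tendsto_log_faceR0_div`, for every integral face direction `2η_j < η₀`), from
Mathlib's Stirling bounds; (i)–(ii) stay on paper.  Contents: the Stirling error `logFactErr m = log m! − (m log m − m)`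
with `0 ≤ logFactErr m ≤ log m / 2 + 1` (`m ≥ 1`; lower bound = `Stirling.le_log_factorial_stirling`, upper bound =
antitonicity of `log ∘ stirlingSeq` from `s₁ = e/√2`); `logFactErr (α n)/n → 0`; `log (c n + d)/n → 0`; the one-block
rate `(1/n) log[(αn)! (βn)! / ((α+β)n + 1)!] → α log α + β log β − (α+β) log(α+β)` (`tendsto_log_block_div`); the
verbatim boundary value `faceR0` (= `R_n(0)` above, in the `h`-variables), its block form, and the rate; and, TYPED
ONLY, `faceR` = `R(t)` itself as a real function of `t` and `faceF` = the form (8.6) `½ Σ_{t ≥ 0} R″(t)`, with the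
dictionary check `faceR_zero : faceR … 0 = faceR0 …`.  The limit is written with real subtractions, i.e. literally
`−Σ_j blockRate η₀ η_j` of the companion file.  Standard axioms only.
-/

noncomputable section

open Real Filter Topology Finset

namespace Summit.KontsevichZagierPeriods.Zeta5Search.WellPoisedFaceRate

/-! ## 1. Stirling error term -/

/-- Stirling error `E(m) = log m! − (m log m − m)`. -/
def logFactErr (m : ℕ) : ℝ := Real.log (m.factorial : ℝ) - ((m : ℝ) * Real.log m - m)

/-- `logFactErr 0 = 0`. -/
@[simp] theorem logFactErr_zero : logFactErr 0 = 0 := by simp [logFactErr]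

/-- `log m! = (m log m − m) + logFactErr m` (definition unfolded). -/
theorem log_factorial_eq (m : ℕ) :
    Real.log (m.factorial : ℝ) = (m : ℝ) * Real.log m - m + logFactErr m := by
  unfold logFactErr; ring

/-- `0 ≤ E(m) ≤ log m / 2 + 1` for `m ≥ 1`.  Lower: Mathlib's effective Stirling lower bound; upper: the log-Stirling
sequence is antitone from `s₁ = e/√2` [folklore; the upper half is the argument of the tree's `log_factorial_le`]. -/
theorem logFactErr_bounds {m : ℕ} (hm : m ≠ 0) :
    0 ≤ logFactErr m ∧ logFactErr m ≤ Real.log m / 2 + 1 := by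
  have hlog : 0 ≤ Real.log m := Real.log_nonneg (by exact_mod_cast Nat.one_le_iff_ne_zero.mpr hm)
  constructor
  · have h := Stirling.le_log_factorial_stirling hm
    have hπ : 0 ≤ Real.log (2 * π) := Real.log_nonneg (by nlinarith [Real.pi_gt_three])
    unfold logFactErr
    linarith
  · obtain ⟨k, rfl⟩ := Nat.exists_eq_succ_of_ne_zero hm
    have h := Stirling.log_stirlingSeq'_antitone (Nat.zero_le k)
    simp only [Function.comp_apply, Nat.succ_eq_add_one, zero_add, Stirling.stirlingSeq_one] at h
    rw [Stirling.log_stirlingSeq_formula, Real.log_div (Real.exp_pos 1).ne' (by positivity),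
      Real.log_exp, Real.log_sqrt zero_le_two, Real.log_mul two_ne_zero (by positivity),
      Real.log_div (by positivity) (Real.exp_pos 1).ne', Real.log_exp] at h
    unfold logFactErr
    push_cast at h ⊢
    nlinarith [h, Real.log_nonneg (show (1 : ℝ) ≤ (k : ℝ) + 1 by
      have : (0 : ℝ) ≤ k := Nat.cast_nonneg k
      linarith)]

/-! ## 2. Elementary limits -/

/-- `log (c n + d) / n → 0` (`c, d ≥ 0`). -/
theorem tendsto_log_linear_div {c d : ℝ} (hc : 0 ≤ c) (hd : 0 ≤ d) :
    Tendsto (fun n : ℕ => Real.log (c * n + d) / n) atTop (𝓝 0) := by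
  rcases hc.eq_or_lt with rfl | hc
  · simpa using tendsto_const_div_atTop_nhds_zero_nat (Real.log d)
  have h1 : Tendsto (fun x : ℝ => Real.log x / x) atTop (𝓝 0) := by
    simpa using Real.tendsto_pow_log_div_mul_add_atTop 1 0 1 one_ne_zero
  have h2 : Tendsto (fun n : ℕ => c * (n : ℝ) + d) atTop atTop :=
    tendsto_atTop_add_const_right _ d (tendsto_natCast_atTop_atTop.const_mul_atTop hc)
  have h3 : Tendsto (fun n : ℕ => (c * (n : ℝ) + d) / n) atTop (𝓝 c) := by
    have : Tendsto (fun n : ℕ => c + d / (n : ℝ)) atTop (𝓝 (c + 0)) :=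
      tendsto_const_nhds.add (tendsto_const_div_atTop_nhds_zero_nat d)
    rw [add_zero] at this
    refine this.congr' ?_
    filter_upwards [eventually_ne_atTop 0] with n hn
    have hn' : (n : ℝ) ≠ 0 := by exact_mod_cast hn
    field_simp
  have h4 := (h1.comp h2).mul h3
  rw [zero_mul] at h4
  refine h4.congr' ?_
  filter_upwards [eventually_ne_atTop 0] with n hn
  have hn' : (0 : ℝ) < n := by exact_mod_cast Nat.pos_of_ne_zero hn
  have hpos : c * (n : ℝ) + d ≠ 0 := by positivity
  simp only [Function.comp_apply]
  field_simp

/-- `E(α n) / n → 0`. -/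
theorem tendsto_logFactErr_mul_div (α : ℕ) :
    Tendsto (fun n : ℕ => logFactErr (α * n) / n) atTop (𝓝 0) := by
  rcases Nat.eq_zero_or_pos α with rfl | hα
  · simp
  have hαr : (0 : ℝ) ≤ α := Nat.cast_nonneg α
  have hup : Tendsto (fun n : ℕ => Real.log ((α : ℝ) * n + 0) / n / 2 + 1 / (n : ℝ)) atTop
      (𝓝 ((0 : ℝ) / 2 + 0)) :=
    ((tendsto_log_linear_div hαr le_rfl).div_const 2).add (tendsto_const_div_atTop_nhds_zero_nat 1)
  rw [zero_div, add_zero] at hup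
  refine tendsto_of_tendsto_of_tendsto_of_le_of_le' tendsto_const_nhds hup ?_ ?_
  · filter_upwards [eventually_ne_atTop 0] with n hn
    have hαn : α * n ≠ 0 := mul_ne_zero hα.ne' hn
    exact div_nonneg (logFactErr_bounds hαn).1 (Nat.cast_nonneg n)
  · filter_upwards [eventually_ne_atTop 0] with n hn
    have hαn : α * n ≠ 0 := mul_ne_zero hα.ne' hn
    have hn' : (0 : ℝ) < n := by exact_mod_cast Nat.pos_of_ne_zero hn
    have hb := (logFactErr_bounds hαn).2
    have : logFactErr (α * n) / n ≤ (Real.log ((α * n : ℕ) : ℝ) / 2 + 1) / n :=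
      div_le_div_of_nonneg_right hb hn'.le
    calc logFactErr (α * n) / n ≤ (Real.log ((α * n : ℕ) : ℝ) / 2 + 1) / n := this
      _ = Real.log ((α : ℝ) * n + 0) / n / 2 + 1 / n := by rw [add_zero]; push_cast; ring

/-- `(αn) log(αn) = αn log α + αn log n` (all `α, n : ℕ`, using `log 0 = 0`). -/
theorem cast_mul_log_mul (α n : ℕ) :
    ((α * n : ℕ) : ℝ) * Real.log ((α * n : ℕ) : ℝ) = (α : ℝ) * n * Real.log α + (α : ℝ) * n * Real.log n := by
  rcases Nat.eq_zero_or_pos α with rfl | hα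
  · simp
  rcases Nat.eq_zero_or_pos n with rfl | hn
  · simp
  have hα' : (α : ℝ) ≠ 0 := by exact_mod_cast hα.ne'
  have hn' : (n : ℝ) ≠ 0 := by exact_mod_cast hn.ne'
  push_cast
  rw [Real.log_mul hα' hn']
  ring

/-! ## 3. One block -/

/-- The block `(αn)! (βn)! / ((α+β)n + 1)!` (= `(h₀ − 2h_j)! (h_j − 1)! / (h₀ − h_j)!` with `α = η₀ − 2η_j`, `β = η_j`). -/
def block (α β n : ℕ) : ℝ :=
  (((α * n).factorial : ℕ) : ℝ) * (((β * n).factorial : ℕ) : ℝ) / ((((α + β) * n + 1).factorial : ℕ) : ℝ)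

/-- The factorial block `(αn)!(βn)!/((α+β)n+1)!` is positive. -/
theorem block_pos (α β n : ℕ) : 0 < block α β n := by
  unfold block; positivity

/-- The rate of one block: `(1/n) log block → α log α + β log β − (α+β) log(α+β)`. -/
theorem tendsto_log_block_div (α β : ℕ) :
    Tendsto (fun n : ℕ => Real.log (block α β n) / n) atTop
      (𝓝 ((α : ℝ) * Real.log α + (β : ℝ) * Real.log β - ((α : ℝ) + β) * Real.log ((α : ℝ) + β))) := by
  set L : ℝ := (α : ℝ) * Real.log α + (β : ℝ) * Real.log β - ((α : ℝ) + β) * Real.log ((α : ℝ) + β) with hL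
  have hγ : (0 : ℝ) ≤ (α : ℝ) + β := by positivity
  have hE : Tendsto (fun n : ℕ => logFactErr (α * n) / n + logFactErr (β * n) / n
      - logFactErr ((α + β) * n) / n - Real.log (((α : ℝ) + β) * n + 1) / n) atTop (𝓝 (0 + 0 - 0 - 0)) :=
    (((tendsto_logFactErr_mul_div α).add (tendsto_logFactErr_mul_div β)).sub
      (tendsto_logFactErr_mul_div (α + β))).sub (tendsto_log_linear_div hγ zero_le_one)
  simp only [add_zero, sub_zero] at hE
  have hmain := (tendsto_const_nhds : Tendsto (fun _ : ℕ => L) atTop (𝓝 L)).add hE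
  rw [add_zero] at hmain
  refine hmain.congr' ?_
  filter_upwards [eventually_ne_atTop 0] with n hn
  have hn' : (n : ℝ) ≠ 0 := by exact_mod_cast hn
  have hf1 : (((α * n).factorial : ℕ) : ℝ) ≠ 0 := by positivity
  have hf2 : (((β * n).factorial : ℕ) : ℝ) ≠ 0 := by positivity
  have hf3 : ((((α + β) * n).factorial : ℕ) : ℝ) ≠ 0 := by positivity
  have hs : ((((α + β) * n + 1 : ℕ)) : ℝ) ≠ 0 := by positivity
  have hden : ((((α + β) * n + 1).factorial : ℕ) : ℝ)
      = (((α + β) * n + 1 : ℕ) : ℝ) * ((((α + β) * n).factorial : ℕ) : ℝ) := by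
    rw [Nat.factorial_succ]; push_cast; ring
  unfold block
  rw [hden, Real.log_div (mul_ne_zero hf1 hf2) (mul_ne_zero hs hf3), Real.log_mul hf1 hf2, Real.log_mul hs hf3,
    log_factorial_eq (α * n), log_factorial_eq (β * n), log_factorial_eq ((α + β) * n),
    cast_mul_log_mul, cast_mul_log_mul, cast_mul_log_mul, hL]
  push_cast
  field_simp
  ring

/-! ## 4. The boundary value `R_n(0)` on the face and its rate -/

/-- VERBATIM `R_n(0) = h₀ · ∏_{j=4}^{7} (h₀ − 2h_j)! (h_j − 1)! / (h₀ − h_j)!` on the ray `h₀ = η₀ n + 2`,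
`h_j = η_j n + 1` (`j = 4..7 ↦ Fin 4`; natural subtraction is honest as soon as `2η_j < η₀`). -/
def faceR0 (η₀ : ℕ) (η : Fin 4 → ℕ) (n : ℕ) : ℝ :=
  ((η₀ * n + 2 : ℕ) : ℝ) * ∏ j : Fin 4,
    ((((η₀ * n + 2) - 2 * (η j * n + 1)).factorial : ℕ) : ℝ) * ((((η j * n + 1) - 1).factorial : ℕ) : ℝ)
      / ((((η₀ * n + 2) - (η j * n + 1)).factorial : ℕ) : ℝ)

/-- Block form: `R_n(0) = (η₀ n + 2) · ∏_j block (η₀ − 2η_j) η_j n`. -/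
theorem faceR0_eq_blocks (η₀ : ℕ) (η : Fin 4 → ℕ) (hη : ∀ j, 2 * η j < η₀) (n : ℕ) :
    faceR0 η₀ η n = ((η₀ * n + 2 : ℕ) : ℝ) * ∏ j : Fin 4, block (η₀ - 2 * η j) (η j) n := by
  unfold faceR0 block
  congr 1
  refine Finset.prod_congr rfl fun j _ => ?_
  have h1 : η₀ * n + 2 - 2 * (η j * n + 1) = (η₀ - 2 * η j) * n := by
    rw [Nat.sub_mul, mul_assoc]; omega
  have h2 : η j * n + 1 - 1 = η j * n := by omega
  have hle : η j * n ≤ η₀ * n := Nat.mul_le_mul_right n (by have := hη j; omega)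
  have h3 : η₀ * n + 2 - (η j * n + 1) = (η₀ - 2 * η j + η j) * n + 1 := by
    have : η₀ - 2 * η j + η j = η₀ - η j := by have := hη j; omega
    rw [this, Nat.sub_mul]; omega
  rw [h1, h2, h3]

/-- `R_n(0) > 0` on every integral face direction. -/
theorem faceR0_pos (η₀ : ℕ) (η : Fin 4 → ℕ) (hη : ∀ j, 2 * η j < η₀) (n : ℕ) : 0 < faceR0 η₀ η n := by
  rw [faceR0_eq_blocks η₀ η hη]
  exact mul_pos (by positivity) (Finset.prod_pos fun j _ => block_pos _ _ _)

/-- Zudilin's `R(t)` on the numerator-free face, ray member `n` [(8.7), with the very-well-poised factor `h₀ + 2t`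
of (8.2)], as a real function of `t`: `(h₀ + 2t) · ∏_{j=4}^{7} (h₀ − 2h_j)! / ∏_{i=0}^{h₀−2h_j} (t + h_j + i)`
(`h₀ = η₀ n + 2`, `h_j = η_j n + 1`; the three pair factors are `≡ 1` at `h₁ = h₂ = h₃ = 1`). -/
def faceR (η₀ : ℕ) (η : Fin 4 → ℕ) (n : ℕ) (t : ℝ) : ℝ :=
  (((η₀ * n + 2 : ℕ) : ℝ) + 2 * t) * ∏ j : Fin 4,
    ((((η₀ * n + 2) - 2 * (η j * n + 1)).factorial : ℕ) : ℝ)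
      / ∏ i ∈ Finset.range ((η₀ * n + 2) - 2 * (η j * n + 1) + 1), (t + ((η j * n + 1 : ℕ) : ℝ) + (i : ℝ))

/-- Zudilin's form (8.6) on the face, TYPED ONLY: `F(h) = (1/(r−1)!) Σ_{t ≥ 1−h₁} R″(t) = ½ Σ_{t ≥ 0} R″(t)`.  Its
positivity and the sandwich `18 R(0)/h₀² ≤ F ≤ 125 h₀³ R(0)` (boundary lemma (i)–(ii)) are proved on paper only. -/
def faceF (η₀ : ℕ) (η : Fin 4 → ℕ) (n : ℕ) : ℝ :=
  (1 / 2 : ℝ) * ∑' t : ℕ, iteratedDeriv 2 (faceR η₀ η n) (t : ℝ)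

/-- Dictionary check: `R_n(0) = faceR0` (the Pochhammer `(h_j)_{h₀−2h_j+1} = (h₀ − h_j)!/(h_j − 1)!`). -/
theorem faceR_zero (η₀ : ℕ) (η : Fin 4 → ℕ) (hη : ∀ j, 2 * η j < η₀) (n : ℕ) :
    faceR η₀ η n 0 = faceR0 η₀ η n := by
  unfold faceR faceR0
  simp only [mul_zero, add_zero, zero_add]
  congr 1
  refine Finset.prod_congr rfl fun j _ => ?_
  have hle : 2 * (η j * n) ≤ η₀ * n := by
    have := Nat.mul_le_mul_right n (hη j).le
    rwa [mul_assoc] at this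
  have hprod : ∏ i ∈ Finset.range ((η₀ * n + 2) - 2 * (η j * n + 1) + 1), (((η j * n + 1 : ℕ) : ℝ) + (i : ℝ))
      = (((η j * n + 1).ascFactorial ((η₀ * n + 2) - 2 * (η j * n + 1) + 1) : ℕ) : ℝ) := by
    rw [Nat.ascFactorial_eq_prod_range, Nat.cast_prod]
    exact Finset.prod_congr rfl fun i _ => by norm_cast
  have hasc : ((((η j * n + 1) - 1).factorial : ℕ) : ℝ)
      * (((η j * n + 1).ascFactorial ((η₀ * n + 2) - 2 * (η j * n + 1) + 1) : ℕ) : ℝ)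
      = ((((η₀ * n + 2) - (η j * n + 1)).factorial : ℕ) : ℝ) := by
    have key := Nat.factorial_mul_ascFactorial (η j * n) ((η₀ * n + 2) - 2 * (η j * n + 1) + 1)
    have h1 : η j * n + 1 - 1 = η j * n := by omega
    have h2 : η j * n + ((η₀ * n + 2) - 2 * (η j * n + 1) + 1) = (η₀ * n + 2) - (η j * n + 1) := by omega
    rw [h1, ← h2]
    exact_mod_cast key
  have hA : (((η j * n + 1).ascFactorial ((η₀ * n + 2) - 2 * (η j * n + 1) + 1) : ℕ) : ℝ) ≠ 0 := by
    exact_mod_cast (Nat.ascFactorial_pos _ _).ne'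
  rw [hprod, div_eq_div_iff hA (by positivity), ← hasc]
  ring

/-- THE RATE (boundary lemma (iii)): `(1/n) log R_n(0) → −Σ_j g(η₀, η_j)` on every integral face direction. -/
theorem tendsto_log_faceR0_div (η₀ : ℕ) (η : Fin 4 → ℕ) (hη : ∀ j, 2 * η j < η₀) :
    Tendsto (fun n : ℕ => Real.log (faceR0 η₀ η n) / n) atTop
      (𝓝 (-∑ j : Fin 4, (((η₀ : ℝ) - η j) * Real.log ((η₀ : ℝ) - η j)
          - ((η₀ : ℝ) - 2 * η j) * Real.log ((η₀ : ℝ) - 2 * η j) - (η j : ℝ) * Real.log (η j)))) := by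
  have hη₀ : (0 : ℝ) ≤ η₀ := Nat.cast_nonneg η₀
  -- head factor
  have hhead : Tendsto (fun n : ℕ => Real.log ((η₀ : ℝ) * n + 2) / n) atTop (𝓝 0) :=
    tendsto_log_linear_div hη₀ zero_le_two
  -- blocks
  have hblocks : Tendsto (fun n : ℕ => ∑ j : Fin 4, Real.log (block (η₀ - 2 * η j) (η j) n) / n) atTop
      (𝓝 (∑ j : Fin 4, ((((η₀ - 2 * η j : ℕ)) : ℝ) * Real.log (((η₀ - 2 * η j : ℕ)) : ℝ)
        + (η j : ℝ) * Real.log (η j)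
        - ((((η₀ - 2 * η j : ℕ)) : ℝ) + η j) * Real.log ((((η₀ - 2 * η j : ℕ)) : ℝ) + η j)))) :=
    tendsto_finsetSum _ fun j _ => tendsto_log_block_div (η₀ - 2 * η j) (η j)
  have hsum := hhead.add hblocks
  rw [zero_add] at hsum
  have key : ∀ n : ℕ, n ≠ 0 → Real.log (faceR0 η₀ η n) / n
      = Real.log ((η₀ : ℝ) * n + 2) / n + ∑ j : Fin 4, Real.log (block (η₀ - 2 * η j) (η j) n) / n := by
    intro n hn
    rw [faceR0_eq_blocks η₀ η hη, Real.log_mul (by positivity)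
      (Finset.prod_pos fun j _ => block_pos _ _ _).ne', Real.log_prod fun j _ => (block_pos _ _ _).ne',
      add_div, Finset.sum_div]
    push_cast
    ring
  have hlim : (∑ j : Fin 4, ((((η₀ - 2 * η j : ℕ)) : ℝ) * Real.log (((η₀ - 2 * η j : ℕ)) : ℝ)
        + (η j : ℝ) * Real.log (η j)
        - ((((η₀ - 2 * η j : ℕ)) : ℝ) + η j) * Real.log ((((η₀ - 2 * η j : ℕ)) : ℝ) + η j)))
      = -∑ j : Fin 4, (((η₀ : ℝ) - η j) * Real.log ((η₀ : ℝ) - η j)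
          - ((η₀ : ℝ) - 2 * η j) * Real.log ((η₀ : ℝ) - 2 * η j) - (η j : ℝ) * Real.log (η j)) := by
    rw [← Finset.sum_neg_distrib]
    refine Finset.sum_congr rfl fun j _ => ?_
    have h2 : 2 * η j ≤ η₀ := (hη j).le
    have hc : (((η₀ - 2 * η j : ℕ)) : ℝ) = (η₀ : ℝ) - 2 * η j := by push_cast [Nat.cast_sub h2]; ring
    rw [hc]
    have hs : (η₀ : ℝ) - 2 * η j + η j = (η₀ : ℝ) - η j := by ring
    rw [hs]
    ring
  rw [← hlim]
  refine hsum.congr' ?_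
  filter_upwards [eventually_ne_atTop 0] with n hn
  exact (key n hn).symm

end Summit.KontsevichZagierPeriods.Zeta5Search.WellPoisedFaceRate

end
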